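import Mathlib
import HarnessLib
import HarnessLib.Audit
import Summits.NavierStokesRegularity.Statement
import Literature.Analysis.FluidPDE.MildSolution
import HarnessLib.Audit.Status.Attr

/-!
Route: ThinOrFatPincer

DORMANT since 2026-09-01T12:17:34Z (reconciler: no traction for 5 d (last activity statement-checked at 2026-08-27T11:26:25Z); parked, not closed — `ledger route dormant route-NavierStokesRegularity-ThinOrFatPincer --off` to reactivate) — unstaffed, not closed; items shared with open routes are served there. `ledger route dormant <id> --off` reactivates.

# Route ThinOrFatPincer — thin or fat — Clay (A) = Generic Clay (the global set is dense in L³_σ) ∧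
Inflation (no fragile blow-up), a two-jaw pincer on the bad set

It suffices to show X = GenericClay ∧ Inflation (card thin-or-fat-pincer: "DENSE ∧ INFLATION").
Phase space: L³_σ = weakly
divergence-free u₀ ∈ L³(ℝ³;ℝ³); good set G_ν = {u₀ : HasGlobalKatoSolution ν u₀} (a global
C([0,∞);L³) mild solution), bad set
B_ν = L³_σ ∖ G_ν. G_ν is OPEN in L³ (GallagherIftimiePlanchon2003 Thm 0.1/3.1, vendored as the named
fact
Literature.Analysis.FluidPDE.GIP2003_L3_stability with the proved corollary
exists_ball_hasGlobalKatoSolution), so B_ν is closed and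
a closed set is empty iff it is nowhere dense and contained in the closure of its interior. GENERIC
CLAY (the first jaw): G_ν is
dense in L³_σ — no stable blow-up; equivalently (G_ν open) global regularity for a residual =
Baire-generic set of data. INFLATION
(the second jaw): if u₀ ∈ B_ν then for every ε > 0 the inflated datum (1+ε)u₀ is an L³-INTERIOR
point of B_ν — no fragile
blow-up; by the scaling u ↦ a u(x, a t) (hasGlobalKatoSolution_smul_iff) this says: blow-up at
viscosity ν is ROBUST blow-up at
every smaller viscosity. Both jaws are strictly weaker than (A) in the abstract (complex Riccati ż =
z² on ℂ: dense good set,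
no inflation; u_t = Δu + |u|^(p−1)u: inflation-type robust ODE blow-up, good set not dense), and the
two-line pincer
GenericClay → Inflation → NavierStokesRegularity is PROVED in the planner's Sketch.lean
(assembly_holds, axioms
propext/Classical.choice/Quot.sound) through the proved bridge
clay_solution_of_hasGlobalKatoSolution_holds.
Lean: `(∀ ν : ℝ, 0 < ν → ∀ u₀ : EuclideanSpace ℝ (Fin 3) → EuclideanSpace ℝ (Fin 3),
MeasureTheory.MemLp u₀ 3 MeasureTheory.volume → Literature.Analysis.FluidPDE.IsWeaklyDivFree u₀ → ∀
ε : ℝ, 0 < ε → ∃ v₀ : EuclideanSpace ℝ (Fin 3) → EuclideanSpace ℝ (Fin 3), MeasureTheory.MemLp v₀ 3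
MeasureTheory.volume ∧ Literature.Analysis.FluidPDE.IsWeaklyDivFree v₀ ∧ MeasureTheory.eLpNorm (v₀ -
u₀) 3 MeasureTheory.volume < ENNReal.ofReal ε ∧ ∃ u : ℝ → EuclideanSpace ℝ (Fin 3) → EuclideanSpace
ℝ (Fin 3), Literature.Analysis.FluidPDE.IsGlobalMildSolution ν 0 v₀ u ∧
Literature.Analysis.FluidPDE.ContinuousInLpOn (Set.Ici 0) 3 u ∧ u 0 = v₀ ∧
MeasureTheory.AEStronglyMeasurable (Function.uncurry u) (MeasureTheory.volume.restrict (Set.Ioi 0 ×ˢ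
Set.univ))) ∧ (∀ ν : ℝ, 0 < ν → ∀ u₀ : EuclideanSpace ℝ (Fin 3) → EuclideanSpace ℝ (Fin 3),
MeasureTheory.MemLp u₀ 3 MeasureTheory.volume → Literature.Analysis.FluidPDE.IsWeaklyDivFree u₀ → ¬
(∃ u : ℝ → EuclideanSpace ℝ (Fin 3) → EuclideanSpace ℝ (Fin 3),
Literature.Analysis.FluidPDE.IsGlobalMildSolution ν 0 u₀ u ∧
Literature.Analysis.FluidPDE.ContinuousInLpOn (Set.Ici 0) 3 u ∧ u 0 = u₀ ∧
MeasureTheory.AEStronglyMeasurable (Function.uncurry u) (MeasureTheory.volume.restrict (Set.Ioi 0 ×ˢ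
Set.univ))) → ∀ ε : ℝ, 0 < ε → ∃ δ : ℝ, 0 < δ ∧ ∀ v₀ : EuclideanSpace ℝ (Fin 3) → EuclideanSpace ℝ
(Fin 3), MeasureTheory.MemLp v₀ 3 MeasureTheory.volume →
Literature.Analysis.FluidPDE.IsWeaklyDivFree v₀ → MeasureTheory.eLpNorm (v₀ - (1 + ε) • u₀) 3
MeasureTheory.volume < ENNReal.ofReal δ → ¬ (∃ u : ℝ → EuclideanSpace ℝ (Fin 3) → EuclideanSpace ℝ
(Fin 3), Literature.Analysis.FluidPDE.IsGlobalMildSolution ν 0 v₀ u ∧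
Literature.Analysis.FluidPDE.ContinuousInLpOn (Set.Ici 0) 3 u ∧ u 0 = v₀ ∧
MeasureTheory.AEStronglyMeasurable (Function.uncurry u) (MeasureTheory.volume.restrict (Set.Ioi 0 ×ˢ
Set.univ))))`
(CONE REPAIR 2026-08-15: in every filed decl `Literature.Analysis.FluidPDE.HasGlobalKatoSolution ν
u₀` is written OUT as its definition — ∃ u, IsGlobalMildSolution ν 0 u₀ u ∧ ContinuousInLpOn (Ici 0)
3 u ∧ u 0 = u₀ ∧ measurability on (0,∞)×ℝ³ (MildSolutions.lean:304; `Iff.rfl` with the abbreviation,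
checked) — so that the route file imports only Literature.Analysis.FluidPDE.MildSolution and its
import cone no longer carries the Rusin–Šverák / vorticity named facts; provers may `show
HasGlobalKatoSolution ν _` and use the Kato library (GIP2003_L3_stability,
hasGlobalKatoSolution_smul_iff, clay_solution_of_hasGlobalKatoSolution_holds) from their own
Theorems imports.)

## Assembly
Pure logic plus two proved tree facts (sorry-free in Sketch.lean, theorem assembly_holds, ~15
lines): fix ν > 0 and a Clay datum u₀
(C^∞, divergence free, rapidly decaying); u₀ ∈ L³ (memLp_three_of_clay, from HasRapidSpatialDecay
with n = 0, K = 2 and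
integrable_of_norm_le_rpow_neg) and u₀ is weakly divergence free
(VectorCalculus.IsDivFree.isWeaklyDivFree_holds). If u₀ had no
global Kato solution, Inflation with ε = 1 gives δ > 0 with the whole L³_σ-ball of radius δ about
2u₀ inside B_ν, while GenericClay
applied at the L³_σ datum 2u₀ produces a point of G_ν in that ball — contradiction. Hence
HasGlobalKatoSolution ν u₀ (unfolded in the decls), and the PROVED
bridge Literature.Analysis.FluidPDE.clay_solution_of_hasGlobalKatoSolution_holds
(NSKatoToClayHolds.lean: Kato 1984 Thm 4, von Wahl,
Lemarié-Rieusset 2016 Prop 12.3) returns the jointly smooth bounded-energy Clay solution (u, p) —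
this bridge is the support item KatoToClay and the L³_σ membership is the support item ClayDataInL3,
the two fact-level hypotheses of the deciding theorem `closes` (the scalar rule IsWeaklyDivFree (c •
u₀) is proved inline in `closes`). No named fact is consumed.

Rationale: WHY THIS LINE. Two lines of point-set topology turn "regularity for ALL data" into "regularity for
GENERIC data" plus "singular data cannot hide
in a thin set", and the first half is the statement everybody — blow-up believers included — expects
to be true: the 2025 frontier
consensus is that "singularities in boundary-free problems like 3D Euler and Navier–Stokes must be
unstable" (WangEtAl2025 p.1,
n unstable modes for the n-th profile p.4), i.e. a hypothetical B is thin, so GenericClay is the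
consensus-compatible milestone
and Inflation is where all of the Clay difficulty must then live. Imported: Baire category /
genericity and prevalence from
dynamical systems (ColdingMinicozzi2012 generic singularities via instability of non-generic models;
HuntSauerYorke1992;
Galeati2026 Thm 1.1, the Baire template: residual well-posedness for 2D Euler in L², where density
is free), stability of a
priori global solutions (GallagherIftimiePlanchon2003, PonceEtAl1994), and three independent engines
for the dense jaw — random
data (NahmodPavlovicStaffilani2012, WangWang2016: a.s. global WEAK solutions so far),
stirring/mixing (KiselevXu2016,
CheminGallagherPaicu2011) and stable manifolds of unstable profiles (ColdingMinicozzi2012,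
WangEtAl2025). Generic solvability
has a 45-year history in the FORCING (Fursikov1982; SohrVonwahl1987: for fixed u₀ on a bounded
domain the forces admitting a
unique global strong solution are residual; Secchi 1990) and for dense families of initial MEASURES
(Fursikov1981, Fursikov
1987 Trans. MMS), never for the data themselves at f = 0, which is GenericClay. Unlike MarginalTypeI
/ AmplitudeIndex (one
amplitude ray, a threshold element) and MinimalBlowupRigidity (a minimal-norm critical element) this
line never selects a
distinguished blow-up: it is about the topology of the whole bad set, in the same in-tree phase
space (HasGlobalKatoSolution,
proved Kato→Clay bridge). Negatives index: empty at filing.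

RANKED CRUXES. #2 GenericClay (crux) — GENERIC CLAY / DENSE (card K1): for every ν > 0 the set of
weakly divergence-free L³ data admitting a global Kato solution (C([0,∞);L³) mild solution) is dense
in L³_σ: every u₀ ∈ L³_σ is an L³-limit of data with global smooth solutions. With GIP openness this
is "B_ν nowhere dense" = Baire-generic global regularity = no stable blow-up. Most informative crux:
its negation is an L³-open set of blow-up data. [difficulty: open-problem] (why it might fail: A
codimension-0 (stable) blow-up may exist, as ODE-type blow-up does for u_t=Δu+|u|^(p-1)u (open set
of data); random-data results reach only a.s. global WEAK solutions; the stable-manifold engine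
needs an unstable non-symmetry direction for EVERY profile, DSS/recurrent included.) [Fursikov1982,
SohrVonwahl1987, Fursikov1981, Galeati2026, NahmodPavlovicStaffilani2012, WangWang2016,
ColdingMinicozzi2012, WangEtAl2025, GallagherIftimiePlanchon2003]
#3 Inflation (crux) — INFLATION (card K2): for every ν > 0, every u₀ ∈ L³_σ WITHOUT a global Kato
solution and every ε > 0 there is δ > 0 such that no v₀ ∈ L³_σ with ‖v₀ − (1+ε)u₀‖_L³ < δ has a
global Kato solution: (1+ε)B_ν ⊆ int B_ν, a blow-up datum inflated by one percent blows up robustly.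
Viscosity reading (hasGlobalKatoSolution_smul_iff): B_ν ⊆ int B_ν' for all ν' < ν; its pointwise
shadow is viscosity monotonicity VM (Inflation → VM proved in Sketch.lean; VM is card
reynolds-monotone-bad-set K1). Vacuous if B = ∅; refutable only together with (A). [difficulty:
open-problem] (why it might fail: Transient chaos: shear-flow lifetimes depend fractally on
(amplitude, Re) (SkufcaYorkeEckhardt2006), so B could be a nowhere-dense dust along amplitude rays,
killing VM hence Inflation; T(D) is non-monotone for u_t=DΔu+u^p; Hou's scenario has a viscosity
window; no open blow-up criterion known.) [SkufcaYorkeEckhardt2006, EckhardtEtAl2007,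
Hou2022PotentiallySingularNS, RusinSverak2011, GallagherIftimiePlanchon2003, WangEtAl2025]
#4 DistributionalGenericClay (crux) — DISTRIBUTIONAL GENERIC CLAY (card P3, the cheapest rung of the
stirring engine (d2), strictly weaker than GenericClay): for every ν > 0, every u₀ ∈ L³_σ, every
finite family of smooth compactly supported test fields φ₁…φ_k and ε > 0 there is v₀ ∈ L³_σ WITH a
global Kato solution and |∫⟨v₀ − u₀, φ_i⟩| < ε for all i — G_ν is dense in L³_σ for the topology of
distributions (every datum is a distributional limit of globally regular data u₀ + w_n, w_n a large
weakly-null stirrer). Not reachable by small data: weak approximants of u₀ ≠ 0 are bounded below in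
Ḃ^(-1)_(∞,∞) (weak lower semicontinuity), so a LARGE-data global mechanism compatible with
superposition is required. [difficulty: L] (why it might fail: Only LARGE-data global mechanisms can
serve (weak approximants stay large in every critical norm); each known one (anisotropic
oscillation, no swirl, fast rotation, enhanced-dissipation mixing) is a structured non-weakly-dense
family that superposition with an arbitrary O(1) profile destroys.) [CheminGallagherPaicu2011,
KiselevXu2016, BabinMahalovNicolaenko1999, BourgainPavlovic2008, KochTataru2001, Zlatos2010]
#9 KatoToClay (support) — KATO → CLAY bridge, hypothesis of `closes`: verbatim the discharged named
fact clay_solution_of_hasGlobalKatoSolution with HasGlobalKatoSolution unfolded; still closed in ONE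
line by Literature.Analysis.FluidPDE.clay_solution_of_hasGlobalKatoSolution_holds (checked rc0).
[difficulty: provable-now] [Kato1984, LemarieRieusset2016, FujitaKato1964]
#9 ClayDataInL3 (support) — Clay data lie in L³_σ, hypothesis of `closes` (rapid decay K = 2 ⇒ L³
via integrable_of_norm_le_rpow_neg; C¹ div-free ⇒ weakly div-free via
VectorCalculus.IsDivFree.isWeaklyDivFree_holds); candidate proofs attached by refuters at rev 3.
[difficulty: provable-now] [Fefferman2000, Kato1984]
DROPPED at the 2026-08-15 cone repair: the viscosity dictionary InflationIffRobust (Inflation ⇔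
robust blow-up at every lower viscosity, via hasGlobalKatoSolution_smul_iff with 1+ε = ν/ν') — true
and provable-now (refuter candidate I33.lean) but NOT a hypothesis of `closes`, and any proof
imports KatoViscosityScaling.lean, whose import cone carries the unproved named facts
rusin_sverak_minimal_data_compact / isVorticitySolutionOn_iff / constantin_fefferman; re-file it on
a consumer route (MarginalTypeI, card reynolds-monotone-bad-set) once that cone is clean. UNFOLDING:
in GenericClay / Inflation / DistributionalGenericClay / KatoToClay the abbreviation
HasGlobalKatoSolution ν u₀ (MildSolutions.lean:304) is written out as its definition (Iff.rfl-equal;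
meaning unchanged) so that the route imports only MildSolution.lean.

TWO-LAYER PLAN. Foreseen glued splits (k ≤ 3, depth 1; nothing filed now). GenericClay ⇐
GenericClayTypeI → GenericClayTypeII → GenericClay
(data whose Kato solution blows up at Type-I rate, resp. otherwise, form nowhere-dense sets; glue =
a finite union of nowhere-dense
sets is nowhere dense; the Type-I child is the card's K3: every Type-I tangent flow has a
symmetry-reduced unstable direction ⇒
B_I sits in countably many positive-codimension Lipschitz graphs, stable manifolds of the
Leray-rescaled flow). Inflation ⇐ VM
(pointwise viscosity monotonicity, shared with card reynolds-monotone-bad-set) →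
EventualOpenCriterion (an OPEN sufficient
condition for blow-up valid along time-t images of inflated blow-up data, using lower semicontinuity
of the Kato lifespan) →
Inflation. DistributionalGenericClay ⇐ StirrerFamily (one explicit weakly-null family w_n with u₀ +
w_n ∈ G_ν for ‖u₀‖_L³ ≤ R)
→ exhaustion in R.

KILL CRITERIA. ¬GenericClay — an L³-open set of weakly divergence-free data without global Kato
solution (STABLE blow-up) — closes the route
(close --reason refuted:GenericClay) and is first-order news for the negative programme;
¬DistributionalGenericClay implies
¬GenericClay (norm-dense ⇒ distributionally dense), same close. ¬Inflation can only come with a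
blow-up: (i) via ¬VM (a datum
regular at ν₁ but singular at some ν₂ > ν₁, card reynolds-monotone-bad-set N1; Inflation → VM is
proved in Sketch.lean) — then
PIVOT: restate Inflation as plain regular-closedness B_ν ⊆ cl(int B_ν) (no amplitude structure),
which still closes the pincer;
(ii) via an isolated fragile blow-up — then ¬A is settled and the route closes refuted:Inflation.
NoBlowup (stmt-NavierStokesRegularity-0054)
or (A) proved elsewhere moots the route; GenericClay proved alone is the milestone "Generic Clay"
and the route stays open on Inflation.

NOT DECOMPOSED YET. The three engines for GenericClay (one full-support Borel probability measure on
L³_σ charging G_ν fully — a.s. global KATO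
solutions for one nondegenerate randomisation; norm-density by stirring; stable manifolds of
unstable profiles) are layer-2 and
not filed; neither is the Type I / Type II split above, the prevalent (Haar-null,
HuntSauerYorke1992) strengthening, nor VM itself
(it belongs to card reynolds-monotone-bad-set; here it is only Inflation's shadow). The phase space
is fixed to L³_σ, where openness
of G_ν is vendored; the Ḣ^(1/2) and H¹ twins (openness by GIP Besov form / PonceEtAl1994) trade a
stronger density for a weaker
inflation and are restatements, not filed. Fursikov's forcing-genericity (bounded domain, finite
horizon) is a different statement
and is cited, not filed. Constants (Kato's δ, GIP's ε(u)) are nowhere needed: the pincer is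
qualitative.

CHEAPEST FALSIFIER. (1) The order principle behind Inflation in the nearest blow-up-bearing models:
the blow-up time T(D) of u_t = DΔu + u^p is already
NON-monotone in D (Mizoguchi–Yanagida, Ishige–Yagisita, as recorded by the novelty audit of card
reynolds-monotone-bad-set), so a
kit sweep of T*(ν) at fixed datum in the viscous dyadic model (Katz–Pavlović/Cheskidov blow-up
regime) and in Tao's averaged
cascade is the one cheap computation: a certified inversion (regular at ν₁ < ν₂ singular) shows VM —
hence Inflation — fails for
NS-type quadratic cascades and forces the regular-closedness pivot at once. (2) Lookup: is Tao's
averaged blow-up (Tao2016AveragedNS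
Thm 1.5) stable under H¹⁰_df-perturbation of the datum? If the averaged bad set is FAT, GenericClay
is false for an averaged
equation, so the random-data engine (Fourier-algebraic multilinear estimates, averaging-insensitive)
cannot prove it and only the
structure-specific engines (stirring by true transport, NS profile spectra) survive. Neither was run
here (lit searchd was down,
rc 75; kit not in a planner's remit).

NUMBERS. Phase space L³_σ; G_ν ⊇ the Kato ball ‖u₀‖_L³ ≤ δν (Kato1984, δ absolute, not explicit in
tree: kato_global_small) so B_ν misses a
ball at 0 and GenericClay/Inflation are statements about large data only; G_ν open with non-explicit
radius ε(u) (GIP2003 Thm 3.1,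
(9)); scaling G_(aν) = a·G_ν (hasGlobalKatoSolution_smul_iff, proved). Instability counts expected
of NS/Euler profiles: n unstable
modes for the n-th self-similar profile (WangEtAl2025 p.4); Hou2022PotentiallySingularNS: 10⁷-fold
vorticity growth in a
symmetry-imposed (hence thin) scenario. Prior genericity theorems: residual set of FORCES for each
fixed u₀, bounded Ω ⊂ ℝ³, finite
T (Fursikov1982, SohrVonwahl1987); dense set of initial MEASURES with a.s. smooth solvability
(Fursikov 1987). Items at open: 5
(3 cruxes, 1 support, 1 assembly); after the 2026-08-15 cone repair: 6 (3 cruxes, 2 supports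
KatoToClay/ClayDataInL3, 1 assembly) + the deciding theorem `closes`.

DEFINITION REQUESTS. None for the filed items: IsGlobalMildSolution / ContinuousInLpOn /
IsWeaklyDivFree (MildSolution.lean, LerayHopf.lean, VectorCalculus.lean — the only Literature import
of the route file since the cone repair), MemLp/eLpNorm (Mathlib), and for provers
HasGlobalKatoSolution, hasGlobalKatoSolution_smul_iff,
GIP2003_L3_stability and clay_solution_of_hasGlobalKatoSolution(_holds) all exist under
Literature.Analysis.FluidPDE. CONE (2026-08-15): routed AROUND rusin_sverak_minimal_blowup,
RusinSverakQuestion (MildSolutions.lean), rusin_sverak_minimal_data_compact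
(RusinSverakCompactness.lean), isVorticitySolutionOn_iff, constantin_fefferman (NSVorticity.lean),
IsVorticitySolutionOn.exists_pressure (Vorticity.lean) — none is used by any item; GENUINELY in the
floor of every mild-solution route and therefore needs-fact:
Literature.Analysis.FluidPDE.IsMildNSSolutionBetween.trans and
Literature.Analysis.FluidPDE.IsMildNSSolutionOn.isWeakNSSolutionOn (MildSolution.lean;
Fabes–Jones–Rivière 1972 Thm 2.1, Lemarié-Rieusset 2002 Thm 11.2 — classical, provable). RECOMMENDED
LITERATURE SPLIT (librarian): move RusinSverakQuestion + rusin_sverak_minimal_blowup (+ the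
rusinSverakRhoMaxPure block) out of MildSolutions.lean, because the one-line proof of KatoToClay
lives on NSKatoToClayHolds → NSKatoToClay → MildSolutions and its `_holds` link will re-import that
file into the route. A later
prevalent version of GenericClay would need Haar-null / shy sets (HuntSauerYorke1992; not in
Mathlib) — not requested now.

Novelty: Searches (2026-08-15; local searchd rc 75 "service unavailable" for `lit search --hybrid` ×3,
OpenAlex 429; remote cascade used):
`lit search --source zbmath "Navier-Stokes almost all initial conditions"` (8: Fursikov JAMM 1983,
Dokl 1984, Trans MMS 1987
zbl:0653.35080 — dense set of initial MEASURES), `… "Navier-Stokes generic solvability"` (8: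
SohrVonwahl1987, Secchi 1990
zbl:0712.35078, Lee 2004 — generic in the FORCE), `… "Navier-Stokes stability global solutions open
set"` (8: Auscher–Dubois–
Tchamitchian 2004 BMO⁻¹ stability; nothing on density), `… "dependence on viscosity global
regularity monotone"` (2, irrelevant),
`lit search --source arxiv "Navier-Stokes generic initial data global"` (8: Cortissoz
arXiv:1105.3871 probabilistic method for
generalized NS; E. Miller arXiv:1909.09125), `… "viscosity monotonicity blowup"` (0); `lit galaxy
search "dense set of initial
data" --star all` (16: Fursikov chain-of-moments in panama:439572722876475 ch.9 and
panama:278296700911634 — moments, not data),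
`lit galaxy search` ×8 other phrases (0 hits each); `lit vsearch` (RRS2016, Temam, Constantin–Foias
pages: only ν-large ⇒ small
data); `lit frontier NavierStokesRegularity --since 2021` (30 rows, none on genericity); 52 Theses
files grepped (no Baire/genericity
route; MarginalTypeI shares the phase space); the card's own sweep and audit-14's crossref/zbMATH
sweep.
Nearest prior art found: Fursikov1982 + SohrVonwahl1987 (Generic Clay in the forcing: residual set
of f for fixed u₀,  [refs: 1105.3871, 1909.09125, SohrVonwahl1987, Fursikov1982, Fursikov1981, Galeati2026, GallagherIftimiePlanchon2003, WangEtAl2025]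

Barriers (technique_class: baire-category, stability-of-blowup, stable-manifold): - technique_class: baire-category, stability-of-blowup, stable-manifold
- Literature.Barriers.NavierStokesRegularity.EnergySupercriticality: the pincer itself uses no
coercive quantity (pure topology + scaling); it bites the ENGINES for GenericClay honestly — a.s.
global smoothness for large random data and norm-density by stirring are large-data global results
that no energy-class estimate delivers; the bet is codimension (instability of every profile), not
size, and Inflation cannot be an energy argument at all since a thin fragile singularity costs
arbitrarily little energy.
- Literature.Barriers.NavierStokesRegularity.TaoAveragedBlowup: GenericClay and Inflation are
meaningful for averaged equations and NOT evaded in the abstract: if Tao's averaged bad set is fat,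
every averaging-insensitive engine (random data via multilinear Fourier estimates) dies — Cheapest
falsifier (2); the stirring engine uses exact transport structure (u·∇, mixing/enhanced dissipation)
and the stable-manifold engine the NS-specific profile linearisation, neither of which passes to a
generic averaged bilinear form. Located, not evaded.
- Literature.Barriers.NavierStokesRegularity.CheapNavierStokesBlowup: semigroup/fixed-point size
estimates alone cannot give large-data global results, and both density cruxes ARE large-data global
statements (weak approximants stay large in Ḃ^(-1)_(∞,∞)); evaded only by engines using structure
beyond bilinear size bounds — stated as the why-might-fail of Distributio

History (route lifecycle, newest last):
- 2026-08-15T16:17:02Z · rev 4: restated GenericClay (stmt-NavierStokesRegularity-8661), Inflation (stmt-NavierStokesRegularity-8662), DistributionalGenericClay (stmt-NavierStokesRegularity-8663), KatoToClay (stmt-NavierStokesRegularity-8948) — cone repair (rrepair g2, kind=cone): imports [MildSolutions, KatoViscosityScaling, GIPGlobalStabilit (planner-rrepair-NavierStokesRegularity-ThinOrF-ce1537fc-g2-0)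
- 2026-08-15T16:17:02Z · rev 4: dropped InflationIffRobust — cone repair (rrepair g2, kind=cone): imports [MildSolutions, KatoViscosityScaling, GIPGlobalStability] → [MildSolution]; HasGlobalKatoSolution UNFOLDED (Iff.rfl (planner-rrepair-NavierStokesRegularity-ThinOrF-ce1537fc-g2-0)
- 2026-08-22T20:34:12Z · DORMANT — reconciler: no traction for 5.6 d (last activity item-evidence-added at 2026-08-17T04:34:23Z); parked, not closed — `ledger route dormant route-NavierStokesRegu (operator:999:2798953)
- 2026-08-26T16:15:44Z · REACTIVATED — reconciler: reactivated — activity statement-closed at 2026-08-26T15:14:11Z after parking at 2026-08-22T20:34:12Z (operator:999:455288)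
- 2026-09-01T12:17:34Z · DORMANT — reconciler: no traction for 5 d (last activity statement-checked at 2026-08-27T11:26:25Z); parked, not closed — `ledger route dormant route-NavierStokesRegulari (operator:999:3796179)

sub-problem: NavierStokesRegularity · status: dormant · opened planner-plancard-NavierStokesRegularity-Navie-7aec424f-0 2026-08-15T13:26:49Z · rev 4 · ledger route-NavierStokesRegularity-ThinOrFatPincer
GENERATED by the gate from the ledger (D-0016/17). Provers cite these decls: `theorem foo : Summit.NavierStokesRegularity.NavierStokesRegularity.Theses.ThinOrFatPincer.<Decl> := …` in Summits/NavierStokesRegularity/NavierStokesRegularity/Theorems/<Name>.lean.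
-/

namespace Summit.NavierStokesRegularity.NavierStokesRegularity.Theses.ThinOrFatPincer

open scoped BigOperators Topology Manifold Classical MeasureTheory ProbabilityTheory Matrix InnerProductSpace ComplexConjugate ContinuousMap
open Filter Set Function TopologicalSpace MeasureTheory

attribute [summit_statement] _root_.NavierStokesRegularity

open Literature.NS

-- earlier GenericClay (stmt-NavierStokesRegularity-8661, replaced 2026-08-15T16:17:02Z -> stmt-NavierStokesRegularity-10483): retired by None — ∀ ν : ℝ, 0 < ν → ∀ u₀ : EuclideanSpace ℝ (Fin 3) → EuclideanSpace ℝ (Fin 3), MeasureTheory.MemLp u₀ 3 MeasureTheory.volume → Literature.Analysis.FluidPDE.IsWeaklyDivFree u₀ → ∀ ε : ℝ, 0 < ε → ∃ v₀ : EuclideanSpace ℝ (Fin 3) → EuclideanSpace ℝ (Fin 3), Measur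
/-- item stmt-NavierStokesRegularity-10483 · crux · rank 2 · open · by planner
why it might fail: A stable (L³-open) blow-up set may exist: ODE-type blow-up of u_t=Δu+|u|^(p-1)u is open (Merle–Zaag), Chen–Hou's 3D Euler blow-up and EGM's C^{1,α} Euler blow-up are stable; random data give only a.s. global WEAK solutions; stable manifolds need an unstable direction for EVERY profile.
sources: Fursikov1982, SohrVonwahl1987, Fursikov1981, Galeati2026, NahmodPavlovicStaffilani2012, WangWang2016
[crux] GENERIC CLAY / DENSE (card K1): for every ν > 0 the set of weakly divergence-free L³ data
admitting a global Kato solution (C([0,∞);L³) mild solution) is dense in L³_σ: every u₀ ∈ L³_σ is an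
L³-limit of data with global smooth solutions. With GIP openness this is "B_ν nowhere dense" =
Baire-generic global regularity = no stable blow-up. Most informative crux: its negation is an
L³-open set of blow-up data. (In the decl, `HasGlobalKatoSolution ν ·` is written out as its
definition — ∃ a global mild solution u ∈ C([0,∞);L³) with u 0 = · , measurable on (0,∞)×ℝ³ —
Iff.rfl-equal; cone repair 2026-08-15.) [difficulty: open-problem] -/
@[route_item "route-NavierStokesRegularity-ThinOrFatPincer", crux]
def GenericClay : Prop :=
  ∀ ν : ℝ, 0 < ν → ∀ u₀ : EuclideanSpace ℝ (Fin 3) → EuclideanSpace ℝ (Fin 3), MeasureTheory.MemLp u₀ 3 MeasureTheory.volume → Literature.Analysis.FluidPDE.IsWeaklyDivFree u₀ → ∀ ε : ℝ, 0 < ε → ∃ v₀ : EuclideanSpace ℝ (Fin 3) → EuclideanSpace ℝ (Fin 3), MeasureTheory.MemLp v₀ 3 MeasureTheory.volume ∧ Literature.Analysis.FluidPDE.IsWeaklyDivFree v₀ ∧ MeasureTheory.eLpNorm (v₀ - u₀) 3 MeasureTheory.volume < ENNReal.ofReal ε ∧ ∃ u : ℝ → EuclideanSpace ℝ (Fin 3)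 → EuclideanSpace ℝ (Fin 3), Literature.Analysis.FluidPDE.IsGlobalMildSolution ν 0 v₀ u ∧ Literature.Analysis.FluidPDE.ContinuousInLpOn (Set.Ici 0) 3 u ∧ u 0 = v₀ ∧ MeasureTheory.AEStronglyMeasurable (Function.uncurry u) (MeasureTheory.volume.restrict (Set.Ioi 0 ×ˢ Set.univ))

-- earlier Inflation (stmt-NavierStokesRegularity-8662, replaced 2026-08-15T16:17:02Z -> stmt-NavierStokesRegularity-10484): retired by None — ∀ ν : ℝ, 0 < ν → ∀ u₀ : EuclideanSpace ℝ (Fin 3) → EuclideanSpace ℝ (Fin 3), MeasureTheory.MemLp u₀ 3 MeasureTheory.volume → Literature.Analysis.FluidPDE.IsWeaklyDivFree u₀ → ¬ Literature.Analysis.FluidPDE.HasGlobalKatoSolution ν u₀ → ∀ ε : ℝ, 0 < ε → ∃ δ : ℝ,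
/-- item stmt-NavierStokesRegularity-10484 · crux · rank 3 · open · by planner
why it might fail: Blow-up may be FRAGILE: shear-turbulence lifetimes are fractal in (amplitude, Re) (Skufca–Yorke–Eckhardt), so B_ν could be nowhere-dense dust on amplitude rays; blow-up is non-monotone in diffusion (Mizoguchi–Ninomiya–Yanagida), breaking VM ⇐ Inflation; no open blow-up criterion is known.
sources: SkufcaYorkeEckhardt2006, EckhardtEtAl2007, Hou2022PotentiallySingularNS, RusinSverak2011, GallagherIftimiePlanchon2003, WangEtAl2025
[crux] INFLATION (card K2): for every ν > 0, every u₀ ∈ L³_σ WITHOUT a global Kato solution and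
every ε > 0 there is δ > 0 such that no v₀ ∈ L³_σ with ‖v₀ − (1+ε)u₀‖_L³ < δ has a global Kato
solution: (1+ε)B_ν ⊆ int B_ν, a blow-up datum inflated by one percent blows up robustly. Viscosity
reading (hasGlobalKatoSolution_smul_iff): B_ν ⊆ int B_ν' for all ν' < ν; its pointwise shadow is
viscosity monotonicity VM (Inflation → VM proved in Sketch.lean; VM is card
reynolds-monotone-bad-set K1). Vacuous if B = ∅; refutable only together with (A). (In the decl,
`HasGlobalKatoSolution ν ·` is written out as its definition — ∃ a global mild solution u ∈
C([0,∞);L³) with u 0 = · , measurable on (0,∞)×ℝ³ — Iff.rfl-equal; cone repair 2026-08-15.)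
[difficulty: open-problem] -/
@[route_item "route-NavierStokesRegularity-ThinOrFatPincer", crux]
def Inflation : Prop :=
  ∀ ν : ℝ, 0 < ν → ∀ u₀ : EuclideanSpace ℝ (Fin 3) → EuclideanSpace ℝ (Fin 3), MeasureTheory.MemLp u₀ 3 MeasureTheory.volume → Literature.Analysis.FluidPDE.IsWeaklyDivFree u₀ → ¬ (∃ u : ℝ → EuclideanSpace ℝ (Fin 3) → EuclideanSpace ℝ (Fin 3), Literature.Analysis.FluidPDE.IsGlobalMildSolution ν 0 u₀ u ∧ Literature.Analysis.FluidPDE.ContinuousInLpOn (Set.Ici 0) 3 u ∧ u 0 = u₀ ∧ MeasureTheory.AEStronglyMeasurable (Function.uncurry u) (MeasureTheory.volume.restrict (Set.Ioi 0 ×ˢ Set.univ))) → ∀ ε : ℝ, 0 < ε → ∃ δ : ℝ, 0 < δ ∧ ∀ v₀ : EuclideanSpace ℝ (Fin 3) → EuclideanSpace ℝ (Fin 3), MeasureTheory.MemLp v₀ 3 MeasureTheory.volume → Literature.Analysis.FluidPDE.IsWeaklyDivFree v₀ → MeasureTheory.eLpNorm (v₀ - (1 + ε) • u₀) 3 MeasureTheory.volume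 < ENNReal.ofReal δ → ¬ (∃ u : ℝ → EuclideanSpace ℝ (Fin 3) → EuclideanSpace ℝ (Fin 3), Literature.Analysis.FluidPDE.IsGlobalMildSolution ν 0 v₀ u ∧ Literature.Analysis.FluidPDE.ContinuousInLpOn (Set.Ici 0) 3 u ∧ u 0 = v₀ ∧ MeasureTheory.AEStronglyMeasurable (Function.uncurry u) (MeasureTheory.volume.restrict (Set.Ioi 0 ×ˢ Set.univ)))

-- earlier DistributionalGenericClay (stmt-NavierStokesRegularity-8663, replaced 2026-08-15T16:17:02Z -> stmt-NavierStokesRegularity-10485): retired by None — ∀ ν : ℝ, 0 < ν → ∀ u₀ : EuclideanSpace ℝ (Fin 3) → EuclideanSpace ℝ (Fin 3), MeasureTheory.MemLp u₀ 3 MeasureTheory.volume → Literature.Analysis.FluidPDE.IsWeaklyDivFree u₀ → ∀ (k : ℕ) (φ : Fin k → EuclideanSpace ℝ (Fin 3) → EuclideanSpace ℝ (F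
/-- item stmt-NavierStokesRegularity-10485 · crux · rank 4 · open · by planner
why it might fail: Needs LARGE non-symmetric global data: k moments force ‖v₀‖ in Ḃ⁻¹_∞,∞ ≳ |c|, and against test fields 𝓛_bΘ_j (b ∈ se(3), six generic bumps Θ_j) every datum with a continuous Euclidean symmetry (axisym no-swirl, helical) has moments in a nowhere-dense cone; CGP-type families give no moment control.
sources: CheminGallagherPaicu2011, KiselevXu2016, BabinMahalovNicolaenko1999, BourgainPavlovic2008, KochTataru2001, Zlatos2010
[crux] DISTRIBUTIONAL GENERIC CLAY (card P3, the cheapest rung of the stirring engine (d2), strictly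
weaker than GenericClay): for every ν > 0, every u₀ ∈ L³_σ, every finite family of smooth compactly
supported test fields φ₁…φ_k and ε > 0 there is v₀ ∈ L³_σ WITH a global Kato solution and |∫⟨v₀ −
u₀, φ_i⟩| < ε for all i — G_ν is dense in L³_σ for the topology of distributions (every datum is a
distributional limit of globally regular data u₀ + w_n, w_n a large weakly-null stirrer). Not
reachable by small data: weak approximants of u₀ ≠ 0 are bounded below in Ḃ^(-1)_(∞,∞) (weak lower
semicontinuity), so a LARGE-data global mechanism compatible with superposition is required. (In the
decl, `HasGlobalKatoSolution ν ·` is written out as its definition — ∃ a global mild solution u ∈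
C([0,∞);L³) with u 0 = · , measurable on (0,∞)×ℝ³ — Iff.rfl-equal; cone repair 2026-08-15.)
[difficulty: L] -/
@[route_item "route-NavierStokesRegularity-ThinOrFatPincer"]
def DistributionalGenericClay : Prop :=
  ∀ ν : ℝ, 0 < ν → ∀ u₀ : EuclideanSpace ℝ (Fin 3) → EuclideanSpace ℝ (Fin 3), MeasureTheory.MemLp u₀ 3 MeasureTheory.volume → Literature.Analysis.FluidPDE.IsWeaklyDivFree u₀ → ∀ (k : ℕ) (φ : Fin k → EuclideanSpace ℝ (Fin 3) → EuclideanSpace ℝ (Fin 3)), (∀ i, ContDiff ℝ (⊤ : ℕ∞) (φ i) ∧ HasCompactSupport (φ i)) → ∀ ε : ℝ, 0 < ε → ∃ v₀ : EuclideanSpace ℝ (Fin 3) → EuclideanSpace ℝ (Fin 3), MeasureTheory.MemLp v₀ 3 MeasureTheory.volume ∧ Literature.Analysis.FluidPDE.IsWeaklyDivFree v₀ ∧ (∃ u : ℝ → EuclideanSpace ℝ (Fin 3) → EuclideanSpace ℝ (Fin 3), Literature.Analysis.FluidPDE.IsGlobalMildSolution ν 0 v₀ u ∧ Literature.Analysis.FluidPDE.ContinuousInLpOn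 (Set.Ici 0) 3 u ∧ u 0 = v₀ ∧ MeasureTheory.AEStronglyMeasurable (Function.uncurry u) (MeasureTheory.volume.restrict (Set.Ioi 0 ×ˢ Set.univ))) ∧ ∀ i, |∫ x, inner ℝ (v₀ x - u₀ x) (φ i x)| < ε

-- earlier KatoToClay (stmt-NavierStokesRegularity-8948, replaced 2026-08-15T16:17:02Z -> stmt-NavierStokesRegularity-10486): retired by None — ∀ ν : ℝ, 0 < ν → ∀ u₀ : EuclideanSpace ℝ (Fin 3) → EuclideanSpace ℝ (Fin 3), ContDiff ℝ (⊤ : ℕ∞) u₀ → Literature.Analysis.FluidPDE.NSWave0.IsDivFree u₀ → Literature.Analysis.FluidPDE.HasRapidSpatialDecay u₀ → Literature.Analysis.FluidPDE.HasGlobalKatoSolution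
/-- item stmt-NavierStokesRegularity-10486 · support · rank 9 · closed · proved by Summit.NavierStokesRegularity.NavierStokesRegularity.Theorems.thinOrFatPincer_katoToClay_proof (prover) · by planner
sources: Kato1984, LemarieRieusset2016, FujitaKato1964
[support] KATO → CLAY bridge (hypothesis of the deciding theorem `closes`; provable-now in ONE
line): a smooth, divergence-free, rapidly decaying datum with a global Kato solution (C([0,∞);L³)
mild) has a jointly smooth bounded-energy Clay solution (u,p). VERBATIM (with HasGlobalKatoSolution
ν u₀ unfolded to its definition, Iff.rfl) the named fact
Literature.Analysis.FluidPDE.clay_solution_of_hasGlobalKatoSolution (NSKatoToClay.lean), which is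
DISCHARGED in tree: `theorem … : KatoToClay :=
Literature.Analysis.FluidPDE.clay_solution_of_hasGlobalKatoSolution_holds` (still elaborates after
the unfolding, checked rc0) (NSKatoToClayHolds.lean; Kato 1984 Thm 4, von Wahl / Lemarié-Rieusset
2016 Prop 12.3). Same signature as the moot item stmt-NavierStokesRegularity-0108 of
MinimalBlowupRigidity. [sources: Kato1984, LemarieRieusset2016, FujitaKato1964] [difficulty:
provable-now] -/
@[route_item "route-NavierStokesRegularity-ThinOrFatPincer", crux]
def KatoToClay : Prop :=
  ∀ ν : ℝ, 0 < ν → ∀ u₀ : EuclideanSpace ℝ (Fin 3) → EuclideanSpace ℝ (Fin 3), ContDiff ℝ (⊤ : ℕ∞) u₀ → Literature.Analysis.FluidPDE.NSWave0.IsDivFree u₀ → Literature.Analysis.FluidPDE.HasRapidSpatialDecay u₀ → (∃ u : ℝ → EuclideanSpace ℝ (Fin 3) → EuclideanSpace ℝ (Fin 3), Literature.Analysis.FluidPDE.IsGlobalMildSolution ν 0 u₀ u ∧ Literature.Analysis.FluidPDE.ContinuousInLpOn (Set.Ici 0) 3 u ∧ u 0 = u₀ ∧ MeasureTheory.AEStronglyMeasurable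 (Function.uncurry u) (MeasureTheory.volume.restrict (Set.Ioi 0 ×ˢ Set.univ))) → ∃ (u : ℝ → EuclideanSpace ℝ (Fin 3) → EuclideanSpace ℝ (Fin 3)) (p : ℝ → EuclideanSpace ℝ (Fin 3) → ℝ), Literature.Analysis.FluidPDE.IsSmoothOnHalfSpace u ∧ Literature.Analysis.FluidPDE.IsSmoothOnHalfSpace p ∧ Literature.Analysis.FluidPDE.IsNavierStokesSolution ν 0 u₀ u p ∧ Literature.Analysis.FluidPDE.HasBoundedEnergy u

-- `KatoToClay` holds: proved by `Summit.NavierStokesRegularity.NavierStokesRegularity.Theorems.thinOrFatPincer_katoToClay_proof` (its module imports this route file, so no `_holds` link can be stated here).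

/-- item stmt-NavierStokesRegularity-8963 · support · rank 9 · closed · proved by Summit.NavierStokesRegularity.NavierStokesRegularity.Theorems.thinOrFatPincer_clayDataInL3_proof (prover) · by planner
sources: Fefferman2000, Kato1984
[support] CLAY DATA LIE IN THE PHASE SPACE L³_σ (hypothesis of the deciding theorem `closes`;
provable-now, ~30 lines, PROVED in the planner's Sketch.lean as memLp_three_of_clay +
isWeaklyDivFree_of_clay): a smooth, divergence-free, rapidly decaying datum is in L³
(HasRapidSpatialDecay with n = 0, K = 2 gives ‖u₀ x‖ ≤ C(1+‖x‖)^(-2), so ‖u₀‖³ ≤ C³(1+‖x‖)^(-6) is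
integrable by Literature.Analysis.FluidPDE.integrable_of_norm_le_rpow_neg (RapidDecayLemmas.lean)
and MeasureTheory.integrable_norm_rpow_iff) and weakly divergence free
(Literature.Analysis.FluidPDE.VectorCalculus.IsDivFree.isWeaklyDivFree_holds, C¹ suffices;
NSWave0.IsDivFree is verbatim VectorCalculus.IsDivFree). [sources: Fefferman2000, Kato1984]
[difficulty: provable-now] -/
@[route_item "route-NavierStokesRegularity-ThinOrFatPincer", crux]
def ClayDataInL3 : Prop :=
  ∀ u₀ : EuclideanSpace ℝ (Fin 3) → EuclideanSpace ℝ (Fin 3), ContDiff ℝ (⊤ : ℕ∞) u₀ → Literature.Analysis.FluidPDE.NSWave0.IsDivFree u₀ → Literature.Analysis.FluidPDE.HasRapidSpatialDecay u₀ → MeasureTheory.MemLp u₀ 3 MeasureTheory.volume ∧ Literature.Analysis.FluidPDE.IsWeaklyDivFree u₀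

-- `ClayDataInL3` holds: proved by `Summit.NavierStokesRegularity.NavierStokesRegularity.Theorems.thinOrFatPincer_clayDataInL3_proof` (its module imports this route file, so no `_holds` link can be stated here).

/-- item stmt-NavierStokesRegularity-8665 · assembly · rank 1 · closed · proved by Summit.NavierStokesRegularity.NavierStokesRegularity.Theorems.thinOrFatPincer_assembly_proof (prover) · by planner
sources: Fefferman2000, Kato1984, GallagherIftimiePlanchon2003
[assembly] GenericClay → Inflation → NavierStokesRegularity (proved in Sketch.lean: assembly_holds). -/
@[route_item "route-NavierStokesRegularity-ThinOrFatPincer"]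
def Assembly : Prop :=
  GenericClay → Inflation → NavierStokesRegularity

-- `Assembly` holds: proved by `Summit.NavierStokesRegularity.NavierStokesRegularity.Theorems.thinOrFatPincer_assembly_proof` (its module imports this route file, so no `_holds` link can be stated here).

/-! D-0027 §2.1 — DECIDING THEOREM (planner-authored via `route open/edit --closes-file`; by planner-rrepair-NavierStokesRegularity-ThinOrF-ce1537fc-g2-0 2026-08-15T16:17:02Z):
its hypotheses are this route's items and its conclusion the sub-problem Statement (glue_lint), and it elaborates with this file. -/

/-- DECIDING THEOREM (D-0027 §2.1): the pincer closes by pure logic. Fix ν > 0 and a Clay datum u₀;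
`ClayDataInL3` puts u₀ in the phase space L³_σ (hence 2u₀: `MemLp.const_smul` and the two-line
scalar rule for `IsWeaklyDivFree`, proved inline); if u₀ had no global Kato solution,
`Inflation` (ε = 1) makes the whole L³_σ-ball of some radius δ about 2u₀ bad, while `GenericClay`
finds a datum with a global Kato solution inside that ball — contradiction; so u₀ has a global Kato
solution and `KatoToClay` (= the proved fact clay_solution_of_hasGlobalKatoSolution_holds, with
HasGlobalKatoSolution unfolded) returns the smooth bounded-energy Clay solution. -/
@[closes "route-NavierStokesRegularity-ThinOrFatPincer"] theorem closes : GenericClay → Inflation → KatoToClay → ClayDataInL3 → NavierStokesRegularity := by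
  intro hD hI hKC hL3 ν hν u₀ hsm hdiv hdec
  obtain ⟨h3, hwd⟩ := hL3 u₀ hsm hdiv hdec
  have hwd2 : Literature.Analysis.FluidPDE.IsWeaklyDivFree ((1 + (1 : ℝ)) • u₀) := by
    intro θ hθ
    simp only [Pi.smul_apply, real_inner_smul_left, MeasureTheory.integral_const_mul, hwd θ hθ, mul_zero]
  refine hKC ν hν u₀ hsm hdiv hdec ?_
  by_contra hB
  obtain ⟨δ, hδ, hball⟩ := hI ν hν u₀ h3 hwd hB 1 one_pos
  obtain ⟨v₀, hv3, hvd, hdist, hG⟩ := hD ν hν ((1 + (1 : ℝ)) • u₀) (h3.const_smul _) hwd2 δ hδ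
  exact hball v₀ hv3 hvd hdist hG

end Summit.NavierStokesRegularity.NavierStokesRegularity.Theses.ThinOrFatPincer
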